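import Summits.Parity.GeneralizedHardyLittlewood.Theorems.LiouvilleShiftedTablesSieveToMAvgI2Expand

/-!
# Sieve glue for `SieveToMAvg`, part 7d: Type I₂ — one corner through the crux

Support file for item stmt-Parity-14274 (route `LiouvilleShiftedTables`).  For a coefficient
sequence `γ'` supported on `r ≤ R` and a corner `(S, y)` (`0 ≤ S ≤ s₂`, `0 ≤ y ≤ 2x`),
Cauchy–Schwarz between the trivial count and the crux (`HypI2`) gives

  `∑_{q ≤ Q, (q,h)=1} ∑_r |γ'(r)| |D(q, r; S, y)|
     ≤ √(2x H_Q H_{s₂} ∑_r γ'(r)²/r + s₂ Q ∑_r γ'(r)²) · √(C₂ X/(log X)^A)`,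

where `H_t = ∑_{n ≤ t} 1/n` and the trivial count of the solutions of `rsn ≡ h (q)` is summed over
the moduli first (part 7a: one class per modulus since `(q, h) = 1`).
-/

namespace Summit.Parity.GeneralizedHardyLittlewood.Theorems.SieveToMAvg

open Finset Real
open scoped ArithmeticFunction.zeta ArithmeticFunction.sigma
open Literature.NumberTheory.Sieve.BFI

/-- The harmonic sum `H_t = ∑_{1 ≤ n ≤ ⌊t⌋} 1/n`. [folklore] -/
noncomputable def Hsum (t : ℝ) : ℝ := ∑ n ∈ Icc 1 ⌊t⌋₊, (n : ℝ)⁻¹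

/-- `H_t ≥ 0`. [folklore] -/
theorem Hsum_nonneg (t : ℝ) : 0 ≤ Hsum t := Finset.sum_nonneg fun n _ => by positivity

/-- `H` is monotone. [folklore] -/
theorem Hsum_mono {t t' : ℝ} (h : t ≤ t') : Hsum t ≤ Hsum t' :=
  Finset.sum_le_sum_of_subset_of_nonneg (Finset.Icc_subset_Icc_right (Nat.floor_le_floor h))
    fun n _ _ => by positivity

/-- `H_Q = ∑_{q ≤ Q} 1/q` for a natural `Q`. [folklore] -/
theorem Hsum_natCast (Q : ℕ) : Hsum Q = ∑ q ∈ Icc 1 Q, (q : ℝ)⁻¹ := by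
  unfold Hsum; rw [Nat.floor_natCast]

/-- The trivial count majorising `|D(q, r; S, y)|`:
`cnt = ∑_{s ≤ S} #{n ≤ y/(sr) : rsn ≡ h (q)}`. [folklore] -/
noncomputable def cntD (h q r : ℕ) (S y : ℝ) : ℝ :=
  ∑ s ∈ Icc 1 ⌊S⌋₊, ((((Icc 1 ⌊y / (s * r)⌋₊).filter (fun n : ℕ => r * s * n ≡ h [MOD q])).card : ℕ) : ℝ)

/-- `|D| ≤ cnt`. [folklore] -/
theorem abs_Dsum_le_cntD (h q r : ℕ) (S y : ℝ) : |Dsum h q r S y| ≤ cntD h q r S y := by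
  unfold Dsum cntD
  refine (Finset.abs_sum_le_sum_abs _ _).trans (Finset.sum_le_sum fun s _ => ?_)
  refine (Finset.abs_sum_le_sum_abs _ _).trans ?_
  calc ∑ n ∈ (Icc 1 ⌊y / (s * r)⌋₊).filter (fun n : ℕ => r * s * n ≡ h [MOD q]), |lamW h (r * s * n)|
      ≤ ∑ _n ∈ (Icc 1 ⌊y / (s * r)⌋₊).filter (fun n : ℕ => r * s * n ≡ h [MOD q]), (1 : ℝ) :=
        Finset.sum_le_sum fun n _ => abs_lamW_le_one h _
    _ = _ := by rw [Finset.sum_const, nsmul_eq_mul, mul_one]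

/-- `cnt ≥ 0`. [folklore] -/
theorem cntD_nonneg (h q r : ℕ) (S y : ℝ) : 0 ≤ cntD h q r S y :=
  Finset.sum_nonneg fun _ _ => Nat.cast_nonneg _

/-- **The count summed over the moduli**: for `r ≥ 1`, `S, y ≥ 0`,
`∑_{q ≤ Q, (q,h)=1} cnt(q, r; S, y) ≤ (y/r) H_Q H_S + S Q`. [folklore] -/
theorem sum_moduli_cntD_le (Q h : ℕ) {r : ℕ} (hr : 0 < r) {S y : ℝ} (hS : 0 ≤ S) (hy : 0 ≤ y) :
    ∑ q ∈ moduli Q h, cntD h q r S y ≤ y / r * Hsum Q * Hsum S + S * Q := by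
  unfold cntD
  rw [Finset.sum_comm]
  have hr0 : (0 : ℝ) < r := by exact_mod_cast hr
  calc ∑ s ∈ Icc 1 ⌊S⌋₊, ∑ q ∈ moduli Q h,
        ((((Icc 1 ⌊y / (s * r)⌋₊).filter (fun n : ℕ => r * s * n ≡ h [MOD q])).card : ℕ) : ℝ)
      ≤ ∑ s ∈ Icc 1 ⌊S⌋₊, (y / (s * r) * Hsum Q + Q) := by
        refine Finset.sum_le_sum fun s hs => ?_
        have hs1 : (1 : ℝ) ≤ s := by exact_mod_cast (Finset.mem_Icc.1 hs).1
        have h1 := sum_moduli_card_filter_le Q h (r * s) (Nat.zero_le ⌊y / (s * r)⌋₊)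
        have hIcc : Icc 1 ⌊y / (s * r)⌋₊ = Ioc 0 ⌊y / (s * r)⌋₊ := rfl
        rw [hIcc]
        refine h1.trans ?_
        rw [Hsum_natCast, Nat.cast_zero, sub_zero]
        have hHQ : 0 ≤ ∑ q ∈ Icc 1 Q, (q : ℝ)⁻¹ := Finset.sum_nonneg fun q _ => by positivity
        have hfl : (⌊y / (s * r)⌋₊ : ℝ) ≤ y / (s * r) := Nat.floor_le (by positivity)
        nlinarith
    _ = (∑ s ∈ Icc 1 ⌊S⌋₊, y / (s * r) * Hsum Q) + ∑ _s ∈ Icc 1 ⌊S⌋₊, (Q : ℝ) := Finset.sum_add_distrib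
    _ ≤ y / r * Hsum Q * Hsum S + S * Q := by
        refine add_le_add (le_of_eq ?_) ?_
        · unfold Hsum
          rw [Finset.mul_sum]
          refine Finset.sum_congr rfl fun s hs => ?_
          have hs0 : (s : ℝ) ≠ 0 := by
            have : 1 ≤ s := (Finset.mem_Icc.1 hs).1
            exact_mod_cast (show s ≠ 0 by omega)
          field_simp
        · rw [Finset.sum_const, Nat.card_Icc, nsmul_eq_mul]
          have : ((⌊S⌋₊ + 1 - 1 : ℕ) : ℝ) ≤ S := by
            rw [Nat.add_sub_cancel]; exact Nat.floor_le hS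
          exact mul_le_mul_of_nonneg_right this (Nat.cast_nonneg Q)

section Corner

variable {h Q : ℕ} {x X ρ' A C₂ s₂ : ℝ}

/-- **One corner**: see the module docstring (`R ≤ 2x` keeps the index sets inside `(0, 2x]`). [folklore] -/
theorem corner_le (hyp : HypI2 X (-(h : ℤ)) h ρ' A C₂) (hx : 0 < x) (hxX : 2 * x ≤ X)
    {R : ℝ} (hR1 : 1 ≤ R) (hRX : R ≤ X ^ ρ') (hRx : R ≤ 2 * x) (hQ : Q ≤ ⌊X ^ ρ'⌋₊)
    {γ' : ArithmeticFunction ℝ} (hγ' : ∀ r : ℕ, γ' r ≠ 0 → (r : ℝ) ≤ R)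
    {S y : ℝ} (hS0 : 0 ≤ S) (hS : S ≤ s₂) (hsR : s₂ * R ≤ X ^ (1 / 2 + ρ')) (hy0 : 0 ≤ y) (hy : y ≤ 2 * x) :
    ∑ q ∈ moduli Q h, ∑ r ∈ Ioc 0 ⌊2 * x⌋₊, |γ' r| * |Dsum h q r S y| ≤
      Real.sqrt (2 * x * Hsum Q * Hsum s₂ * (∑ r ∈ Ioc 0 ⌊2 * x⌋₊, γ' r ^ 2 / r) +
          s₂ * Q * ∑ r ∈ Ioc 0 ⌊2 * x⌋₊, γ' r ^ 2) * Real.sqrt (C₂ * X / Real.log X ^ A) := by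
  classical
  set N := ⌊2 * x⌋₊ with hN
  set Rn := ⌊R⌋₊ with hRn
  have hsub : Icc 1 Rn ⊆ Ioc 0 N := by
    intro r hr
    rw [Finset.mem_Icc] at hr
    rw [Finset.mem_Ioc]
    exact ⟨hr.1, hr.2.trans (Nat.floor_le_floor hRx)⟩
  -- restrict the `r`-sum to `r ≤ R`
  have hres : ∀ q, ∑ r ∈ Ioc 0 N, |γ' r| * |Dsum h q r S y| = ∑ r ∈ Icc 1 Rn, |γ' r| * |Dsum h q r S y| := by
    intro q
    symm
    refine Finset.sum_subset hsub fun r hr hr' => ?_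
    have : γ' r = 0 := by
      by_contra hne
      apply hr'
      rw [Finset.mem_Icc]
      exact ⟨(Finset.mem_Ioc.1 hr).1, Nat.le_floor (hγ' r hne)⟩
    rw [this, abs_zero, zero_mul]
  rw [Finset.sum_congr rfl fun q _ => hres q]
  set P : Finset (ℕ × ℕ) := (moduli Q h) ×ˢ (Icc 1 Rn) with hP
  have hLHS : ∑ q ∈ moduli Q h, ∑ r ∈ Icc 1 Rn, |γ' r| * |Dsum h q r S y| =
      ∑ p ∈ P, |γ' p.2| * |Dsum h p.1 p.2 S y| := by rw [hP, Finset.sum_product]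
  rw [hLHS]
  -- Cauchy–Schwarz over the pairs `(q, r)`
  have hCS := Finset.sum_mul_sq_le_sq_mul_sq P
    (fun p => |γ' p.2| * Real.sqrt |Dsum h p.1 p.2 S y|) (fun p => Real.sqrt |Dsum h p.1 p.2 S y|)
  have hprod : ∀ p ∈ P, |γ' p.2| * Real.sqrt |Dsum h p.1 p.2 S y| * Real.sqrt |Dsum h p.1 p.2 S y| =
      |γ' p.2| * |Dsum h p.1 p.2 S y| := by
    intro p _
    rw [mul_assoc, Real.mul_self_sqrt (abs_nonneg _)]
  rw [Finset.sum_congr rfl hprod] at hCS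
  have hf2 : ∑ p ∈ P, (|γ' p.2| * Real.sqrt |Dsum h p.1 p.2 S y|) ^ 2 = ∑ p ∈ P, γ' p.2 ^ 2 * |Dsum h p.1 p.2 S y| := by
    refine Finset.sum_congr rfl fun p _ => ?_
    rw [mul_pow, Real.sq_sqrt (abs_nonneg _), sq_abs]
  have hg2 : ∑ p ∈ P, Real.sqrt |Dsum h p.1 p.2 S y| ^ 2 = ∑ p ∈ P, |Dsum h p.1 p.2 S y| :=
    Finset.sum_congr rfl fun p _ => Real.sq_sqrt (abs_nonneg _)
  rw [hf2, hg2] at hCS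
  -- the two factors
  have hA : ∑ p ∈ P, γ' p.2 ^ 2 * |Dsum h p.1 p.2 S y| ≤
      2 * x * Hsum Q * Hsum s₂ * (∑ r ∈ Ioc 0 N, γ' r ^ 2 / r) + s₂ * Q * ∑ r ∈ Ioc 0 N, γ' r ^ 2 := by
    rw [hP, Finset.sum_product_right]
    calc ∑ r ∈ Icc 1 Rn, ∑ q ∈ moduli Q h, γ' r ^ 2 * |Dsum h q r S y|
        ≤ ∑ r ∈ Icc 1 Rn, γ' r ^ 2 * (y / r * Hsum Q * Hsum S + S * Q) := by
          refine Finset.sum_le_sum fun r hr => ?_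
          rw [← Finset.mul_sum]
          refine mul_le_mul_of_nonneg_left ?_ (sq_nonneg _)
          have hr0 : 0 < r := (Finset.mem_Icc.1 hr).1
          exact ((Finset.sum_le_sum fun q _ => abs_Dsum_le_cntD h q r S y).trans
            (sum_moduli_cntD_le Q h hr0 hS0 hy0))
      _ ≤ ∑ r ∈ Icc 1 Rn, γ' r ^ 2 * (2 * x / r * Hsum Q * Hsum s₂ + s₂ * Q) := by
          refine Finset.sum_le_sum fun r hr => mul_le_mul_of_nonneg_left ?_ (sq_nonneg _)
          have hr0 : (0 : ℝ) < r := by exact_mod_cast (Finset.mem_Icc.1 hr).1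
          have hHQ := Hsum_nonneg (Q : ℝ)
          have hHS := Hsum_nonneg S
          have hHm := Hsum_mono hS
          gcongr
      _ ≤ ∑ r ∈ Ioc 0 N, γ' r ^ 2 * (2 * x / r * Hsum Q * Hsum s₂ + s₂ * Q) := by
          refine Finset.sum_le_sum_of_subset_of_nonneg hsub fun r hr _ => ?_
          have hr0 : (0 : ℝ) < r := by exact_mod_cast (Finset.mem_Ioc.1 hr).1
          have hHQ := Hsum_nonneg (Q : ℝ)
          have hHS := Hsum_nonneg s₂
          have hs₂ : 0 ≤ s₂ := hS0.trans hS
          positivity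
      _ = 2 * x * Hsum Q * Hsum s₂ * (∑ r ∈ Ioc 0 N, γ' r ^ 2 / r) + s₂ * Q * ∑ r ∈ Ioc 0 N, γ' r ^ 2 := by
          rw [Finset.mul_sum, Finset.mul_sum, ← Finset.sum_add_distrib]
          refine Finset.sum_congr rfl fun r hr => ?_
          have hr0 : (r : ℝ) ≠ 0 := by exact_mod_cast (Finset.mem_Ioc.1 hr).1.ne'
          field_simp
  have hB : ∑ p ∈ P, |Dsum h p.1 p.2 S y| ≤ C₂ * X / Real.log X ^ A := by
    rw [hP, Finset.sum_product]
    have hmod : moduli Q h ⊆ Icc 1 ⌊X ^ ρ'⌋₊ := fun q hq => by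
      have := mem_moduli.1 hq
      rw [Finset.mem_Icc]; exact ⟨this.1.1, this.1.2.trans hQ⟩
    calc ∑ q ∈ moduli Q h, ∑ r ∈ Icc 1 Rn, |Dsum h q r S y|
        ≤ ∑ q ∈ Icc 1 ⌊X ^ ρ'⌋₊, ∑ r ∈ Icc 1 Rn, |Dsum h q r S y| :=
          Finset.sum_le_sum_of_subset_of_nonneg hmod fun q _ _ => Finset.sum_nonneg fun _ _ => abs_nonneg _
      _ ≤ C₂ * X / Real.log X ^ A := by
          refine hyp.sum_abs_Dsum_le hR1 hRX hS0 ?_ hy0 (hy.trans hxX)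
          calc S * R ≤ s₂ * R := mul_le_mul_of_nonneg_right hS (by linarith)
            _ ≤ X ^ (1 / 2 + ρ') := hsR
  -- combine
  have hL0 : 0 ≤ ∑ p ∈ P, |γ' p.2| * |Dsum h p.1 p.2 S y| :=
    Finset.sum_nonneg fun p _ => mul_nonneg (abs_nonneg _) (abs_nonneg _)
  have hA0 : 0 ≤ ∑ p ∈ P, γ' p.2 ^ 2 * |Dsum h p.1 p.2 S y| :=
    Finset.sum_nonneg fun p _ => mul_nonneg (sq_nonneg _) (abs_nonneg _)
  have h1 : ∑ p ∈ P, |γ' p.2| * |Dsum h p.1 p.2 S y| ≤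
      Real.sqrt (∑ p ∈ P, γ' p.2 ^ 2 * |Dsum h p.1 p.2 S y|) * Real.sqrt (∑ p ∈ P, |Dsum h p.1 p.2 S y|) := by
    rw [← Real.sqrt_mul hA0, ← Real.sqrt_sq hL0]
    exact Real.sqrt_le_sqrt hCS
  refine h1.trans (mul_le_mul (Real.sqrt_le_sqrt hA) (Real.sqrt_le_sqrt hB) (Real.sqrt_nonneg _) (Real.sqrt_nonneg _))

end Corner

end Summit.Parity.GeneralizedHardyLittlewood.Theorems.SieveToMAvg
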